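import Summits.QuantumFields.YangMills.Theorems.BalabanUVNodesN15CovariantLandauPerturbation
import HarnessLib

/-!
# Route «BalabanUVNodes», node N15 = NE2, road (c) — PROGRAMME (P-S), I: THE LANDAU SUMMAND FACTORISED THROUGH BAŁABAN's MINIMIZER KERNELS —
# `M(U) := G′(U)Q′*(U)`, `E(U) := D_U G′(U) Q′*(U)`, `Q′G′²Q′* = M*M`, `I − R(U) = M·(Q′G′²Q′*)⁻¹·M*`, `D_U(I − R(U))D*_U = E·(Q′G′²Q′*)⁻¹·E*`, the
# one-difference expansions of `M`, `E`, `Q′G′²Q′*`, `D(I−R)D*` at two backgrounds, and the FIXED-POINT forms of `G′(U)` and `(Q′G′²Q′*)⁻¹(U)` around the flat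
# background (dag-n15-c g23, n15-c∕212)

Cell `pub-ymgap`, seat `pub-ymgap-dag-n15-c` (generation g23; R134 (a), s1; HUMAN RULING D-0062; chair R424 venue).  `bears_on: R4∕N15 · K3⁸ SpineGivenEndpointR13SepCoPHV
(stmt-QuantumFields-27366)`; filed `--supports stmt-QuantumFields-27366 --as helper` — COUNT-NEUTRAL.  Two plumbing `def`s (`cM`, `cE`) + finite matrix algebra ([folklore]); 0 `sorry`;
NO estimate.  Imports BY NAME n15-c∕205 `…N15CovariantLandauPerturbation` (`mmul3_sub`, `claplA_sub`, `cGreen_sub`, `cSop_inv_sub`; through it n15-c∕199 `cGreen_transpose`,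
`claplA_mul_cGreen`, `cGreen_mul_claplA`, `isUnit_cSop`, and n15-c∕197's objects `cgrad`, `csavg`, `claplA`, `cGreen`, `cSop`, `cPi`, `landauCov`).  Nothing in the tree is modified.

WHY (HOME HANDOFF g22 «LOCATED NEXT OBJECT» = the three global rows of n15-c∕211's `hG` for the Landau perturbation letter `N_V^R = D_U(I−R(U))D*_U − ∂Π∂* ⊗ 1_ι`).
[Balaban1985BackgroundPropagators] p. 399 l. 4–8 derives (3.49) — the kernel bounds of `P = I − R`, `DP`, `PD*`, `DPD*` — from Theorem 3.1 (the kernels of `G′(U)`,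
`∇_UG′(U)`, (3.42)) and Theorem 3.2 (the kernel of `(Q′(U)G′²(U)Q′*(U))⁻¹`, (3.48)) *«using again Lemma 2.1»*: `I − R = G′Q′*(Q′G′²Q′*)⁻¹Q′G′` is a PRODUCT of the two
minimizer kernels `M = G′Q′*`, `M*` around the coarse inverse, and `DPD* = (DG′Q′*)·(Q′G′²Q′*)⁻¹·(DG′Q′*)*`.  This factorised form is the door for the sequel n15-c∕214: every
sup-norm block row of `N_V^R` becomes a composition of rows of the PRIMITIVE family {`G′`, `DG′`, `(Q′G′²Q′*)⁻¹` at `U` and at `1`, their one-factor differences} — no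
`∇G′∇*` (Calderón–Zygmund) word ever appears, because the outer gradients always hit a `G′Q′*` (a gradient of a minimizer, bounded).  THIS FILE is the algebra.

OBJECTS AND RESULTS ([folklore] finite matrix algebra; equation tags mark the printed formula an identity transcribes — nothing printed is asserted).
* §1 ★ `cM T a := G′·Q′ᵀ` (the minimizer kernel), ★ `cE T a := D·G′·Q′ᵀ` (its covariant gradient); `cM_transpose`, `cE_eq_cgrad_mul_cM`, `cE_transpose`;
  ★ `cSop_eq_transpose_mul : Q′G′²Q′ᵀ = cMᵀ·cM`, ★ `cPi_eq : I − R = cM·(Q′G′²Q′ᵀ)⁻¹·cMᵀ`, ★★ **`landauCov_eq : D(I−R)Dᵀ = cE·(Q′G′²Q′ᵀ)⁻¹·cEᵀ`** ((3.49)'s factorisation).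
* §2 one-difference expansions at two backgrounds: `cM_sub`, `cE_sub` (through `G′(T) − G′(T′)`, `D_TG′(T) − D_{T′}G′(T′)`, `Q′(T) − Q′(T′)`), `cSop_sub_transpose`
  (`S(T) − S(T′) = (δM)ᵀ·M(T) + M(T′)ᵀ·δM`), ★★ **`landauCov_sub_factorised`** (`δE·S(T)⁻¹·E(T)ᵀ + E(T′)·(S(T)⁻¹ − S(T′)⁻¹)·E(T)ᵀ + E(T′)·S(T′)⁻¹·δEᵀ`).
* §3 the resolvent in one-difference WORDS and the fixed-point forms for the Neumann series of the sequel ([Balaban1985Variational] (188) shape, `B11SectG.neumann_majorant`):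
  ★ `cGreen_sub_words` (`G′(T) − G′(T′) = −G′(T′)(D_T−D_{T′})ᵀ·D_TG′(T) − G′(T′)D_{T′}ᵀ·(D_T−D_{T′})G′(T) − a·G′(T′)(Q_T−Q_{T′})ᵀ·Q_TG′(T) − a·G′(T′)Q_{T′}ᵀ·(Q_T−Q_{T′})G′(T)`),
  ★★ `cGreen_fixedPoint` (`G′(T) = S₀ + K′·G′(T)` with `S₀ = G′(T′) − G′(T′)(D_T−D_{T′})ᵀ·[D_TG′(T)]`, `K′ = −G′(T′)·(D_{T′}ᵀ(D_T−D_{T′}) + a(Q_T−Q_{T′})ᵀQ_T + aQ_{T′}ᵀ(Q_T−Q_{T′}))`),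
  ★★ `cSop_inv_fixedPoint` (`S(T)⁻¹ = S(T′)⁻¹ + (−S(T′)⁻¹(S(T) − S(T′)))·S(T)⁻¹`), `cgrad_mul_cGreen_eq_add` (`D_TG′(T) = D_{T′}G′(T′) + δ(DG′)`).

HONEST FRAMING ∕ LIMITS.  Identities only; no estimate (no decay of `G′`, `(Q′G′²Q′*)⁻¹` is claimed — those are the displayed rows of the sequel); MODEL READING as n15-c∕197
(one averaging level, whole torus, uniform weights in `Δ′_a`, one-level staircases, site transporters).  NOT [Balaban1985BackgroundPropagators] Thms 3.1–3.4; NE2⁺ NOT PRINTED;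
N15 of record untouched (DISCHARGED AS CONSUMED, p687738); counts UNMOVED (typed 28∕28 · discharged 8∕27); one finite 𝕋⁴ at fixed ε per index — NOT infinite volume ∕ OS ∕
mass gap ∕ Clay.  Restate-immune (no Theses import).
-/

noncomputable section

open scoped BigOperators Matrix
open Finset

namespace Summit.QuantumFields.YangMills.BalabanUVNodes.N15.CovLandau

open Literature.MathematicalPhysics.QuantumFieldTheory.Balaban1983to89
open Literature.MathematicalPhysics.QuantumFieldTheory.Balaban1983to89.B5Prop11Plancherel (Tor fine)

variable {d : ℕ} (M : Fin (d + 1) → ℕ) [∀ μ, NeZero (M μ)] (n : ℕ) [NeZero n] {ι : Type} [Fintype ι] [DecidableEq ι]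

/-! ## §1 The minimizer kernels and the factorisation of the Landau summand -/

section Objects

/-- ★ **BAŁABAN's MINIMIZER KERNEL `M(U) := G′(U)·Q′(U)ᵀ`** (fine coloured scalars ← coarse coloured scalars): the columns are the `a`-minimizers `G′Q′*δ_y` whose span is the
range of `I − R(U)` ((3.21), (3.25)). [cite: Balaban1985BackgroundPropagators, (3.25) p.394 (shape), Thm 3.2 (3.48) p.398 (the object `Q′G′²Q′*`)] -/
def cM (T : Fin (d + 1) → Tor (fine n M) → Matrix ι ι ℝ) (a : ℝ) : Matrix (Tor (fine n M) × ι) (Tor M × ι) ℝ :=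
  cGreen M n T a * (csavg M n T)ᵀ

/-- ★ **THE COVARIANT GRADIENT OF THE MINIMIZER KERNEL `E(U) := D_U·G′(U)·Q′(U)ᵀ`** (fine coloured 1-forms ← coarse coloured scalars).
[cite: Balaban1985BackgroundPropagators, (3.49) p.399 (the kernels `(DP)_μ`, `(DPD*)_{μν}`: shape)] -/
def cE (T : Fin (d + 1) → Tor (fine n M) → Matrix ι ι ℝ) (a : ℝ) : Matrix ((Tor (fine n M) × Fin (d + 1)) × ι) (Tor M × ι) ℝ :=
  cgrad M n T * cGreen M n T a * (csavg M n T)ᵀ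

/-- `Mᵀ = Q′·G′` (`G′` is symmetric). [folklore] -/
theorem cM_transpose (T : Fin (d + 1) → Tor (fine n M) → Matrix ι ι ℝ) (a : ℝ) : (cM M n T a)ᵀ = csavg M n T * cGreen M n T a := by
  rw [cM, Matrix.transpose_mul, Matrix.transpose_transpose, cGreen_transpose]

/-- `E = D·M`. [folklore] -/
theorem cE_eq_cgrad_mul_cM (T : Fin (d + 1) → Tor (fine n M) → Matrix ι ι ℝ) (a : ℝ) : cE M n T a = cgrad M n T * cM M n T a := by
  rw [cE, cM, Matrix.mul_assoc]

/-- `Eᵀ = Q′·G′·Dᵀ`. [folklore] -/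
theorem cE_transpose (T : Fin (d + 1) → Tor (fine n M) → Matrix ι ι ℝ) (a : ℝ) : (cE M n T a)ᵀ = csavg M n T * cGreen M n T a * (cgrad M n T)ᵀ := by
  rw [cE, Matrix.transpose_mul, Matrix.transpose_mul, Matrix.transpose_transpose, cGreen_transpose, Matrix.mul_assoc]

/-- ★ `Q′G′²Q′ᵀ = Mᵀ·M`. [cite: Balaban1985BackgroundPropagators, Thm 3.2 (3.48) p.398 (the object); (3.25) p.394] -/
theorem cSop_eq_transpose_mul (T : Fin (d + 1) → Tor (fine n M) → Matrix ι ι ℝ) (a : ℝ) : cSop M n T a = (cM M n T a)ᵀ * cM M n T a := by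
  rw [cM_transpose, cM, cSop]
  simp only [Matrix.mul_assoc]

/-- ★ `I − R(U) = M·(Q′G′²Q′ᵀ)⁻¹·Mᵀ` — the orthogonal projection onto the span of the minimizers. [cite: Balaban1985BackgroundPropagators, (3.25) p.394, (3.21) p.394] -/
theorem cPi_eq (T : Fin (d + 1) → Tor (fine n M) → Matrix ι ι ℝ) (a : ℝ) : cPi M n T a = cM M n T a * (cSop M n T a)⁻¹ * (cM M n T a)ᵀ := by
  rw [cM_transpose, cM, cPi]
  simp only [Matrix.mul_assoc]

/-- ★★ **THE FACTORISATION OF THE LANDAU SUMMAND**: `D_U(I − R(U))D*_U = E·(Q′G′²Q′ᵀ)⁻¹·Eᵀ` with `E = D_UG′(U)Q′(U)ᵀ` — the form in which [B9] p. 399 reads the kernel bounds (3.49) of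
`DPD*` off Theorems 3.1–3.2. [cite: Balaban1985BackgroundPropagators, (3.49) p.399 («These theorems imply all the properties of the operator R, or DRD* … using again Lemma 2.1»), (3.25)–(3.26) pp.394–395] -/
theorem landauCov_eq (T : Fin (d + 1) → Tor (fine n M) → Matrix ι ι ℝ) (a : ℝ) : landauCov M n T a = cE M n T a * (cSop M n T a)⁻¹ * (cE M n T a)ᵀ := by
  rw [cE_transpose, cE, landauCov, cPi]
  simp only [Matrix.mul_assoc]

end Objects

/-! ## §2 One-difference expansions at two backgrounds -/

section Differences

omit [∀ μ, NeZero (M μ)] [NeZero n] [DecidableEq ι] [Fintype ι] in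
/-- Two-factor telescoping for (rectangular) matrices: `AB − A′B′ = (A−A′)B + A′(B−B′)`. [folklore] -/
theorem mmul2_sub {l m p : Type} [Fintype m] (A A' : Matrix l m ℝ) (B B' : Matrix m p ℝ) : A * B - A' * B' = (A - A') * B + A' * (B - B') := by
  simp only [Matrix.sub_mul, Matrix.mul_sub]
  abel

/-- `M(T) − M(T′) = (G′(T) − G′(T′))·Q′(T)ᵀ + G′(T′)·(Q′(T) − Q′(T′))ᵀ`. [folklore] -/
theorem cM_sub (T T' : Fin (d + 1) → Tor (fine n M) → Matrix ι ι ℝ) (a : ℝ) :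
    cM M n T a - cM M n T' a = (cGreen M n T a - cGreen M n T' a) * (csavg M n T)ᵀ + cGreen M n T' a * (csavg M n T - csavg M n T')ᵀ := by
  rw [cM, cM, Matrix.transpose_sub]
  exact mmul2_sub _ _ _ _

/-- `E(T) − E(T′) = (D_TG′(T) − D_{T′}G′(T′))·Q′(T)ᵀ + D_{T′}G′(T′)·(Q′(T) − Q′(T′))ᵀ` — the ONE genuinely covariant difference is the gradient-of-`G′` difference.
[cite: Balaban1985BackgroundPropagators, Thm 3.4 p.400 («small perturbations of the operators depending on U only»: mechanism)] -/
theorem cE_sub (T T' : Fin (d + 1) → Tor (fine n M) → Matrix ι ι ℝ) (a : ℝ) :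
    cE M n T a - cE M n T' a =
      (cgrad M n T * cGreen M n T a - cgrad M n T' * cGreen M n T' a) * (csavg M n T)ᵀ + cgrad M n T' * cGreen M n T' a * (csavg M n T - csavg M n T')ᵀ := by
  rw [cE, cE, Matrix.transpose_sub]
  exact mmul2_sub _ _ _ _

/-- `S(T) − S(T′) = (M(T) − M(T′))ᵀ·M(T) + M(T′)ᵀ·(M(T) − M(T′))` for `S = Q′G′²Q′ᵀ = MᵀM`. [folklore] -/
theorem cSop_sub_transpose (T T' : Fin (d + 1) → Tor (fine n M) → Matrix ι ι ℝ) (a : ℝ) :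
    cSop M n T a - cSop M n T' a = (cM M n T a - cM M n T' a)ᵀ * cM M n T a + (cM M n T' a)ᵀ * (cM M n T a - cM M n T' a) := by
  rw [cSop_eq_transpose_mul, cSop_eq_transpose_mul, Matrix.transpose_sub]
  exact mmul2_sub _ _ _ _

/-- ★★ **THE LANDAU SUMMAND AT TWO BACKGROUNDS, FACTORISED**: `D(I−R)Dᵀ(T) − D(I−R)Dᵀ(T′) = (E(T) − E(T′))·S(T)⁻¹·E(T)ᵀ + E(T′)·(S(T)⁻¹ − S(T′)⁻¹)·E(T)ᵀ + E(T′)·S(T′)⁻¹·(E(T) − E(T′))ᵀ`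
— every word carries ONE difference of a minimizer object; with `T′ = 1` this is the matrix of the knit's `N_V^R` (n15-c∕201 `cvNVr`).
[cite: Balaban1985BackgroundPropagators, (3.49) p.399, Thm 3.4 p.400 (mechanism); (3.26) p.395] -/
theorem landauCov_sub_factorised (T T' : Fin (d + 1) → Tor (fine n M) → Matrix ι ι ℝ) (a : ℝ) :
    landauCov M n T a - landauCov M n T' a =
      (cE M n T a - cE M n T' a) * (cSop M n T a)⁻¹ * (cE M n T a)ᵀ + cE M n T' a * ((cSop M n T a)⁻¹ - (cSop M n T' a)⁻¹) * (cE M n T a)ᵀ +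
        cE M n T' a * (cSop M n T' a)⁻¹ * (cE M n T a - cE M n T' a)ᵀ := by
  rw [landauCov_eq, landauCov_eq, Matrix.transpose_sub]
  exact mmul3_sub _ _ _ _ _ _

/-- `S(T)⁻¹ − S(T′)⁻¹ = −S(T′)⁻¹·(S(T) − S(T′))·S(T)⁻¹` (genuine inverses: invertible transporters, `a > 0`). [folklore] -/
theorem cSop_inv_sub' {T T' : Fin (d + 1) → Tor (fine n M) → Matrix ι ι ℝ} (hT : ∀ ν x, IsUnit (T ν x)) (hT' : ∀ ν x, IsUnit (T' ν x)) {a : ℝ} (ha : 0 < a) :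
    (cSop M n T a)⁻¹ - (cSop M n T' a)⁻¹ = -((cSop M n T' a)⁻¹ * (cSop M n T a - cSop M n T' a) * (cSop M n T a)⁻¹) := by
  rw [← neg_sub ((cSop M n T' a)⁻¹), cSop_inv_sub M n hT' hT ha]

end Differences

/-! ## §3 The resolvent in one-difference words and the fixed-point forms -/

section FixedPoint

/-- ★ **THE RESOLVENT IN ONE-DIFFERENCE WORDS**: with `V = Δ′_a(T) − Δ′_a(T′) = (D_T−D_{T′})ᵀD_T + D_{T′}ᵀ(D_T−D_{T′}) + a((Q_T−Q_{T′})ᵀQ_T + Q_{T′}ᵀ(Q_T−Q_{T′}))`,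
`G′(T) − G′(T′) = −[G′(T′)(D_T−D_{T′})ᵀ]·[D_TG′(T)] − [G′(T′)D_{T′}ᵀ]·[(D_T−D_{T′})G′(T)] − a·[G′(T′)(Q_T−Q_{T′})ᵀ]·[Q_TG′(T)] − a·[G′(T′)Q_{T′}ᵀ]·[(Q_T−Q_{T′})G′(T)]` —
every bare gradient lands on a `G′` (no word `DG′Dᵀ`). [cite: Balaban1985BackgroundPropagators, (3.50)–(3.53) p.400 (expansion of `Δ_{U′U}` around `Δ_U`: mechanism), Thm 3.4 p.400] -/
theorem cGreen_sub_words {T T' : Fin (d + 1) → Tor (fine n M) → Matrix ι ι ℝ} (hT : ∀ ν x, IsUnit (T ν x)) (hT' : ∀ ν x, IsUnit (T' ν x)) {a : ℝ} (ha : 0 < a) :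
    cGreen M n T a - cGreen M n T' a =
      -(cGreen M n T' a * (cgrad M n T - cgrad M n T')ᵀ * (cgrad M n T * cGreen M n T a))
        - cGreen M n T' a * (cgrad M n T')ᵀ * ((cgrad M n T - cgrad M n T') * cGreen M n T a)
        - a • (cGreen M n T' a * (csavg M n T - csavg M n T')ᵀ * (csavg M n T * cGreen M n T a))
        - a • (cGreen M n T' a * (csavg M n T')ᵀ * ((csavg M n T - csavg M n T') * cGreen M n T a)) := by
  have h := cGreen_sub M n hT' hT ha
  -- `G′(T′) − G′(T) = G′(T′)·(Δ′(T) − Δ′(T′))·G′(T)`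
  rw [← neg_sub, neg_eq_iff_eq_neg] at h
  rw [h, claplA_sub]
  simp only [Matrix.mul_add, Matrix.add_mul, Matrix.mul_smul, Matrix.smul_mul, Matrix.mul_assoc, neg_add, smul_add]
  abel

/-- ★★ **THE FIXED-POINT FORM OF `G′(T)` AROUND `G′(T′)`** (for the Neumann series over block majorants, [Balaban1985Variational] (188) ∕ `B11SectG.neumann_majorant`):
`G′(T) = S₀ + K′·G′(T)` with the SOURCE `S₀ = G′(T′) − G′(T′)(D_T−D_{T′})ᵀ·[D_TG′(T)]` (the covariant gradient `D_TG′(T)` read as a datum) and the SMALL OPERATOR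
`K′ = −G′(T′)·(D_{T′}ᵀ(D_T−D_{T′}) + a·(Q_T−Q_{T′})ᵀQ_T + a·Q_{T′}ᵀ(Q_T−Q_{T′}))`. [cite: Balaban1985Variational, (188) p.308 (shape); Balaban1985BackgroundPropagators, Thm 3.4 p.400 (mechanism)] -/
theorem cGreen_fixedPoint {T T' : Fin (d + 1) → Tor (fine n M) → Matrix ι ι ℝ} (hT : ∀ ν x, IsUnit (T ν x)) (hT' : ∀ ν x, IsUnit (T' ν x)) {a : ℝ} (ha : 0 < a) :
    cGreen M n T a =
      (cGreen M n T' a - cGreen M n T' a * (cgrad M n T - cgrad M n T')ᵀ * (cgrad M n T * cGreen M n T a)) +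
        (-(cGreen M n T' a * ((cgrad M n T')ᵀ * (cgrad M n T - cgrad M n T') + a • ((csavg M n T - csavg M n T')ᵀ * csavg M n T) +
          a • ((csavg M n T')ᵀ * (csavg M n T - csavg M n T'))))) * cGreen M n T a := by
  have h := cGreen_sub_words M n hT hT' ha
  rw [sub_eq_iff_eq_add] at h
  conv_lhs => rw [h]
  simp only [Matrix.mul_add, Matrix.add_mul, Matrix.neg_mul, Matrix.mul_smul, Matrix.smul_mul, Matrix.mul_assoc, neg_add]
  abel

/-- ★★ **THE FIXED-POINT FORM OF `(Q′G′²Q′ᵀ)⁻¹(T)` AROUND `(Q′G′²Q′ᵀ)⁻¹(T′)`**: `S(T)⁻¹ = S(T′)⁻¹ + (−S(T′)⁻¹·(S(T) − S(T′)))·S(T)⁻¹`.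
[cite: Balaban1985Variational, (188) p.308 (shape); Balaban1985BackgroundPropagators, Thm 3.4 p.400 (the operator `(Q′(U)G′²(U)Q′*(U))⁻¹` among the perturbed ones)] -/
theorem cSop_inv_fixedPoint {T T' : Fin (d + 1) → Tor (fine n M) → Matrix ι ι ℝ} (hT : ∀ ν x, IsUnit (T ν x)) (hT' : ∀ ν x, IsUnit (T' ν x)) {a : ℝ} (ha : 0 < a) :
    (cSop M n T a)⁻¹ = (cSop M n T' a)⁻¹ + (-((cSop M n T' a)⁻¹ * (cSop M n T a - cSop M n T' a))) * (cSop M n T a)⁻¹ := by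
  have h := cSop_inv_sub' M n hT hT' ha
  rw [sub_eq_iff_eq_add] at h
  conv_lhs => rw [h]
  rw [Matrix.neg_mul]
  abel

/-- `D_TG′(T) = D_{T′}G′(T′) + (D_TG′(T) − D_{T′}G′(T′))` — the covariant gradient of `G′` as the flat one plus its displayed difference. [folklore] -/
theorem cgrad_mul_cGreen_eq_add (T T' : Fin (d + 1) → Tor (fine n M) → Matrix ι ι ℝ) (a : ℝ) :
    cgrad M n T * cGreen M n T a = cgrad M n T' * cGreen M n T' a + (cgrad M n T * cGreen M n T a - cgrad M n T' * cGreen M n T' a) := by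
  abel

/-- `M(T) = G′(T)·Q′(T)ᵀ` read through the fixed point: `M(T) − M(T′)` in terms of `G′(T) − G′(T′)` (`cM_sub`) — restated with the words of `cGreen_sub_words` substituted, so that every
word of `M(T) − M(T′)` is a product of primitive kernels. [folklore] -/
theorem cM_sub_words {T T' : Fin (d + 1) → Tor (fine n M) → Matrix ι ι ℝ} (hT : ∀ ν x, IsUnit (T ν x)) (hT' : ∀ ν x, IsUnit (T' ν x)) {a : ℝ} (ha : 0 < a) :
    cM M n T a - cM M n T' a =
      (-(cGreen M n T' a * (cgrad M n T - cgrad M n T')ᵀ * (cgrad M n T * cGreen M n T a))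
        - cGreen M n T' a * (cgrad M n T')ᵀ * ((cgrad M n T - cgrad M n T') * cGreen M n T a)
        - a • (cGreen M n T' a * (csavg M n T - csavg M n T')ᵀ * (csavg M n T * cGreen M n T a))
        - a • (cGreen M n T' a * (csavg M n T')ᵀ * ((csavg M n T - csavg M n T') * cGreen M n T a))) * (csavg M n T)ᵀ +
      cGreen M n T' a * (csavg M n T - csavg M n T')ᵀ := by
  rw [cM_sub, cGreen_sub_words M n hT hT' ha]

end FixedPoint

end Summit.QuantumFields.YangMills.BalabanUVNodes.N15.CovLandau

end
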